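import Summits.Ventures.HodgeKum4.Theorems.KummerFixedLocusDefs
import Summits.Ventures.HodgeKum4.Theorems.KummerFixedLocusDominatedClasses
import HarnessLib

/-!
# `⟨Λ, ∪⟩`-spans of dominated seeds are dominated
(cell `hodge-kum4`, seat p2; step (iv) of the kernel plan for the span-form node L2a′
`GammaInvariantsDominatedKum4` of route `KummerFixedLocus`)

HONEST FRAMING.  Pure bookkeeping, no named fact.  For `Y`, `B` smooth projective:
* `isCupClosed_totalDominated` — the total dominated classes `totalDominated dY Y dX B ⊆ H*(Y(ℂ); ℂ)`
  (all homogeneous components dominated by the powers of `B`, `KummerFixedLocusDefs`) are closed under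
  the total cup product (`cupProduct_mem_dominatedClasses` componentwise);
* `mem_stabilizerLie_totalDominated` — a total operator `Λ` all of whose degree components
  `Hᵏ → Hᵐ` are `0` or algebraic correspondences preserves `totalDominated`;
* `opCupSpan_le_totalDominated` — hence, if `H⁰`, `H²`, `H³` are dominated, the whole `⟨Λ, ∪⟩`-span
  `opCupSpan Λ (degreeClasses {0,2,3})` (the right-hand side of L1 `LefschetzGenerationKum4`) is
  dominated (`opCupSpan_le`, the minimality of the span).
-/

noncomputable section

open CategoryTheory DirectSum
open Literature.AlgebraicGeometry Literature.AlgebraicGeometry.Motives Literature.AlgebraicGeometry.HodgeTheory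
open Literature.AlgebraicGeometry.Hyperkaehler
open Literature.AlgebraicTopology.SingularHomology

namespace Summit.Ventures.HodgeKum4

variable {dY dX : ℕ} {Y B : SchemeOver ℂ}

/-- A class all of whose components are dominated is the (finite) sum of its homogeneous parts, each
totally dominated. -/
theorem ofDegree_apply_mem_totalDominated {v : totalCohomology ℂ (Motives.ComplexPoints Y)}
    (hv : v ∈ totalDominated dY Y dX B) (i : ℕ) :
    ofDegree ℂ (Motives.ComplexPoints Y) i (v i) ∈ totalDominated dY Y dX B :=
  (ofDegree_mem_totalDominated_iff (v i)).2 (hv i)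

/-- **The total dominated classes are closed under cup product.** -/
theorem isCupClosed_totalDominated (hY : IsSmoothProjective dY Y) (hB : IsSmoothProjective dX B) :
    IsCupClosed (totalDominated dY Y dX B) := by
  classical
  intro x hx y hy
  have hx' : x = ∑ i ∈ x.support, ofDegree ℂ (Motives.ComplexPoints Y) i (x i) :=
    (DirectSum.sum_support_of x).symm
  have hy' : y = ∑ j ∈ y.support, ofDegree ℂ (Motives.ComplexPoints Y) j (y j) :=
    (DirectSum.sum_support_of y).symm
  rw [hx', hy']
  simp only [map_sum, LinearMap.sum_apply]
  refine Submodule.sum_mem _ fun _ _ => Submodule.sum_mem _ fun _ _ => ?_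
  rw [totalCup_lof]
  exact (ofDegree_mem_totalDominated_iff _).2 (cupProduct_mem_dominatedClasses hY hB rfl (hx _) (hy _))

/-- **A degreewise `0`-or-algebraic total operator preserves the total dominated classes.** -/
theorem mem_stabilizerLie_totalDominated (hY : IsSmoothProjective dY Y) (hB : IsSmoothProjective dX B)
    {Λ : Module.End ℂ (totalCohomology ℂ (Motives.ComplexPoints Y))}
    (hΛ : ∀ k m : ℕ,
      DirectSum.component ℂ ℕ _ m ∘ₗ Λ ∘ₗ ofDegree ℂ (Motives.ComplexPoints Y) k = 0 ∨
        IsAlgebraicCorrespondence dY dY Y Y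
          (DirectSum.component ℂ ℕ _ m ∘ₗ Λ ∘ₗ ofDegree ℂ (Motives.ComplexPoints Y) k)) :
    Λ ∈ stabilizerLie (totalDominated dY Y dX B) := by
  classical
  rw [mem_stabilizerLie_iff]
  intro v hv
  have hv' : v = ∑ i ∈ v.support, ofDegree ℂ (Motives.ComplexPoints Y) i (v i) :=
    (DirectSum.sum_support_of v).symm
  rw [hv', map_sum]
  refine Submodule.sum_mem _ fun i _ => ?_
  rw [mem_totalDominated_iff]
  intro m
  rw [DirectSum.apply_eq_component ℂ]
  change (DirectSum.component ℂ ℕ _ m ∘ₗ Λ ∘ₗ ofDegree ℂ (Motives.ComplexPoints Y) i) (v i) ∈ _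
  rcases hΛ i m with h0 | halg
  · rw [h0, LinearMap.zero_apply]
    exact Submodule.zero_mem _
  · exact apply_mem_dominatedClasses hY hY hB halg (hv i)

/-- **Dominated seeds in degrees `0, 2, 3` generate a dominated `⟨Λ, ∪⟩`-span**: for `Λ` degreewise
`0`-or-algebraic, `opCupSpan Λ (degreeClasses {0,2,3}) ≤ totalDominated` — the right-hand side of L1 is
dominated by the powers of `B`. -/
theorem opCupSpan_le_totalDominated (hY : IsSmoothProjective dY Y) (hB : IsSmoothProjective dX B)
    {Λ : Module.End ℂ (totalCohomology ℂ (Motives.ComplexPoints Y))}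
    (hΛ : ∀ k m : ℕ,
      DirectSum.component ℂ ℕ _ m ∘ₗ Λ ∘ₗ ofDegree ℂ (Motives.ComplexPoints Y) k = 0 ∨
        IsAlgebraicCorrespondence dY dY Y Y
          (DirectSum.component ℂ ℕ _ m ∘ₗ Λ ∘ₗ ofDegree ℂ (Motives.ComplexPoints Y) k))
    (h0 : ∀ c : complexBetti Y 0, c ∈ dominatedClasses dY Y dX B 0)
    (h2 : ∀ c : complexBetti Y 2, c ∈ dominatedClasses dY Y dX B 2)
    (h3 : ∀ c : complexBetti Y 3, c ∈ dominatedClasses dY Y dX B 3) :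
    opCupSpan ℂ (Motives.ComplexPoints Y) Λ (degreeClasses ℂ (Motives.ComplexPoints Y) {0, 2, 3}) ≤
      totalDominated dY Y dX B := by
  refine opCupSpan_le ?_ (isCupClosed_totalDominated hY hB) (mem_stabilizerLie_totalDominated hY hB hΛ)
  intro v hv
  simp only [degreeClasses, Set.mem_iUnion, Set.mem_range] at hv
  obtain ⟨k, hk, c, rfl⟩ := hv
  rw [SetLike.mem_coe, ofDegree_mem_totalDominated_iff]
  simp only [Set.mem_insert_iff, Set.mem_singleton_iff] at hk
  rcases hk with rfl | rfl | rfl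
  · exact h0 c
  · exact h2 c
  · exact h3 c

end Summit.Ventures.HodgeKum4

end
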